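import Mathlib
import HarnessLib
import Summits.AtomisticToContinuum.Crystallization.Theorems.PricedLinkCensusSoftFourRingsCapCertSound

/-!
# Bond-to-cap certificate: expansion mode for large certificates (Gram forms and functions supplied as kernel-validated expansions, row-chunked `PartialOK` chains), and `bondToCap_of_checkAll`

Route `PricedLinkCensus`, item `SoftFourRings` (stmt-AtomisticToContinuum-14234), crux `Cap.BondToCap`
(seat c3).  Part 5/5 of the semantics-and-soundness layer of the certificate checker
(`PricedLinkCensusSoftFourRingsCapCertComp`).  Master valid inequality, for a unit pole `p ∉ X` and
unit vectors `X` (`u_x = ⟪p,x⟫`, `t_xy = ⟪x,y⟫`): `Σ_{x,y∈X} Ocore(u_x,u_y,t_xy) + Σ_x Dcross(u_x) + c₀ ≥ 0`;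
splitting at each `x` into the diagonal, four bonded and seven non-bonded terms and moving the free
polynomials with the degree identities gives `0 ≤ Σ D + Σ O_b + Σ O_n + c₀ ≤ 12α + 48β_b + 84β_n + c₀ < 0`.
-/

namespace Summit.AtomisticToContinuum.Crystallization.Theorems.Cap.Cert

open Real RealInnerProductSpace Finset
open Literature.Geometry.DiscreteGeometry Literature.Geometry.DiscreteGeometry.PolyCert
  Literature.Geometry.DiscreteGeometry.PolyCert.SPoly

/-! ### Expansion mode: Gram forms supplied as validated data (for large certificates) -/

/-- The residual check with EXPANSIONS `Rs` in place of the Gram evaluations. [folklore] -/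
def checkExp (S : ℕ) (bound : ℤ) (P : SPoly) (ms Rs : List SPoly) (cslack : ℕ) : Bool :=
  decide (Rs.length = ms.length) &&
  residualBound (smul (4 ^ S) (C bound ++ neg P) ++
    neg (lsum (List.zipWith (fun m R => mulN m R) ms Rs)) ++ neg (C cslack)) cslack

/-- List form of the nonnegativity of `Σ m_i R_i` for validated expansions. [folklore] -/
theorem eval_zipWith_exp_nonneg (u v t : ℝ) : ∀ (ms Rs : List SPoly),
    (∀ m ∈ ms, 0 ≤ eval m u v t) → (∀ R ∈ Rs, 0 ≤ eval R u v t) →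
    0 ≤ eval (lsum (List.zipWith (fun m R => mulN m R) ms Rs)) u v t
  | [], _, _, _ => by simp [lsum]
  | _ :: _, [], _, _ => by simp [lsum]
  | m :: ms, R :: Rs, hms, hRs => by
    rw [List.zipWith_cons_cons, lsum, eval_append, eval_mulN]
    refine add_nonneg (mul_nonneg (hms m (by simp)) (hRs R (by simp))) ?_
    exact eval_zipWith_exp_nonneg u v t ms Rs (fun m' hm' => hms m' (by simp [hm']))
      (fun R' hR' => hRs R' (by simp [hR']))

/-- Domination from an expansion check and validated (nonnegative-on-the-box) expansions. [folklore] -/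
theorem le_of_checkExp (S : ℕ) (bound : ℤ) (P : SPoly) (ms Rs : List SPoly) (cslack : ℕ)
    (h : checkExp S bound P ms Rs cslack = true)
    (hR : ∀ R ∈ Rs, ∀ u v t : ℝ, |u| ≤ 1 → |v| ≤ 1 → |t| ≤ 1 → 0 ≤ eval R u v t)
    {u v t : ℝ} (hu : |u| ≤ 1) (hv : |v| ≤ 1) (ht : |t| ≤ 1) (hms : ∀ m ∈ ms, 0 ≤ eval m u v t) :
    eval P u v t ≤ bound := by
  simp only [checkExp, Bool.and_eq_true, decide_eq_true_eq] at h
  have hr := abs_eval_le_of_residualBound _ _ h.2 hu hv ht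
  simp only [eval_append, eval_smul, eval_C, eval_neg] at hr
  have hsos := eval_zipWith_exp_nonneg u v t ms Rs hms (fun R hR' => hR R hR' u v t hu hv ht)
  have h4 : (0 : ℝ) < (4 : ℝ) ^ S := by positivity
  have hle := (abs_le.1 hr).1
  push_cast at hle
  nlinarith

/-! ### Row-chunked validation of Gram expansions (any number of chunks, one `decide` each) -/

/-- `D` is the expansion of the first `i` rows of the Gram form of `g` (on the box). [folklore] -/
def PartialOK (g : GramBlk) (i : ℕ) (D : SPoly) : Prop :=
  ∀ u v t : ℝ, |u| ≤ 1 → |v| ≤ 1 → |t| ≤ 1 →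
    eval D u v t = ∑ j ∈ Finset.range i, rowVal g u v t j

/-- Start of a chunk chain. [folklore] -/
theorem partialOK_zero (g : GramBlk) : PartialOK g 0 [] := by
  intro u v t _ _ _; simp

/-- One chunk of a chain. [folklore] -/
theorem partialOK_step {g : GramBlk} {i cnt : ℕ} {D D' : SPoly} (h : PartialOK g i D)
    (hc : chunkOK g i cnt D D' = true) : PartialOK g (i + cnt) D' := by
  intro u v t hu hv ht
  rw [eval_of_chunkOK g i cnt D D' hc u v t hu hv ht, h u v t hu hv ht, Finset.range_eq_Ico,
    Finset.sum_Ico_consecutive _ (Nat.zero_le i) (Nat.le_add_right i cnt), ← Finset.range_eq_Ico]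

/-- A completely validated expansion is the Gram form, hence nonnegative on the box. [folklore] -/
theorem nonneg_of_partialOK {g : GramBlk} {R : SPoly} (hlen : g.lenOK = true)
    (h : PartialOK g g.z.length R) (u v t : ℝ) (hu : |u| ≤ 1) (hv : |v| ≤ 1) (ht : |t| ≤ 1) :
    0 ≤ eval R u v t := by
  rw [h u v t hu hv ht, ← eval_quadL_eq_sum_rowVal g hlen]
  exact eval_quadL_nonneg g hlen u v t

/-- A validated expansion of a polynomial (`residualBound (P ++ neg E) 0`): same values on the box.
[folklore] -/
theorem eval_eq_of_expOK {P E : SPoly} (h : residualBound (P ++ neg E) 0 = true) (u v t : ℝ)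
    (hu : |u| ≤ 1) (hv : |v| ≤ 1) (ht : |t| ≤ 1) : eval E u v t = eval P u v t :=
  (eval_eq_of_residual0 P E h u v t hu hv ht).symm

/-- Domination from an expansion check in which the bounded polynomial is itself given by a
validated expansion `E` of `P`. [folklore] -/
theorem le_of_checkExp' (S : ℕ) (bound : ℤ) (P E : SPoly) (ms Rs : List SPoly) (cslack : ℕ)
    (hE : residualBound (P ++ neg E) 0 = true)
    (h : checkExp S bound E ms Rs cslack = true)
    (hR : ∀ R ∈ Rs, ∀ u v t : ℝ, |u| ≤ 1 → |v| ≤ 1 → |t| ≤ 1 → 0 ≤ eval R u v t)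
    {u v t : ℝ} (hu : |u| ≤ 1) (hv : |v| ≤ 1) (ht : |t| ≤ 1) (hms : ∀ m ∈ ms, 0 ≤ eval m u v t) :
    eval P u v t ≤ bound := by
  rw [← eval_eq_of_expOK hE u v t hu hv ht]
  exact le_of_checkExp S bound E ms Rs cslack h hR hu hv ht hms

/-- **Soundness in expansion mode.**  The functions `D, O_b, O_n` are given by validated expansions
`ED, EB, EN`, the Gram forms by expansions `RD, RB, RN` known to be nonnegative on the box (from
chunk chains, `nonneg_of_partialOK`), the three expansion checks pass, the side conditions and the
final inequality hold: then the conclusion of `exists_inner_gt_of_checkAll` holds. -/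
theorem exists_inner_gt_of_checkExp (c : CapCert) (ED EB EN : SPoly) (RD RB RN : List SPoly)
    (hside : (decide (0 < c.cbD) && decide (c.cbN < c.cbD) && checkFinal c) = true)
    (eD : residualBound (DPoly c ++ neg ED) 0 = true) (eB : residualBound (ObPoly c ++ neg EB) 0 = true)
    (eN : residualBound (OnPoly c ++ neg EN) 0 = true)
    (hD : checkExp c.S c.alpha ED (multD c) RD c.cD = true)
    (hBx : checkExp c.S c.betab EB (multB c) RB c.cB = true)
    (hNx : checkExp c.S c.betan EN (multN c) RN c.cN = true)
    (vD : ∀ R ∈ RD, ∀ u v t : ℝ, |u| ≤ 1 → |v| ≤ 1 → |t| ≤ 1 → 0 ≤ eval R u v t)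
    (vB : ∀ R ∈ RB, ∀ u v t : ℝ, |u| ≤ 1 → |v| ≤ 1 → |t| ≤ 1 → 0 ≤ eval R u v t)
    (vN : ∀ R ∈ RN, ∀ u v t : ℝ, |u| ≤ 1 → |v| ≤ 1 → |t| ≤ 1 → 0 ≤ eval R u v t)
    {X : Finset (EuclideanSpace ℝ (Fin 3))} {B : Finset (Finset (EuclideanSpace ℝ (Fin 3)))}
    (hX1 : ∀ y ∈ X, ‖y‖ = 1) (hcard : X.card = 12)
    (hsep : ∀ u ∈ X, ∀ u' ∈ X, u ≠ u' → ⟪u, u'⟫ ≤ 1 - 1 / (2 * (101 / 100 : ℝ) ^ 2))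
    (hB : ∀ T ∈ B, ∃ u ∈ X, ∃ u' ∈ X, u ≠ u' ∧ 1 - (101 / 100 : ℝ) ^ 2 / 2 ≤ ⟪u, u'⟫ ∧ T = {u, u'})
    (hdeg : ∀ v ∈ X, ∃ w : Fin 4 → EuclideanSpace ℝ (Fin 3), (∀ k, w k ∈ X) ∧
      Function.Injective w ∧ (∀ k, w k ≠ v) ∧
      (∀ k, ({v, w k} : Finset (EuclideanSpace ℝ (Fin 3))) ∈ B) ∧
      ∀ y, ({v, y} : Finset (EuclideanSpace ℝ (Fin 3))) ∈ B → ∃ k, y = w k)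
    (hnb : ∀ u ∈ X, ∀ u' ∈ X, u ≠ u' → ({u, u'} : Finset (EuclideanSpace ℝ (Fin 3))) ∉ B →
      ⟪u, u'⟫ < 101 / 200)
    (p : EuclideanSpace ℝ (Fin 3)) (hp : ‖p‖ = 1) :
    ∃ x ∈ X, (c.cbN : ℝ) < c.cbD * ⟪p, x⟫ := by
  simp only [Bool.and_eq_true, decide_eq_true_eq, checkFinal] at hside
  obtain ⟨⟨hcbD, hcb1⟩, hF⟩ := hside
  exact exists_inner_gt_of_dominated c hcbD hcb1 hF
    (fun u v t hu hv ht hms => le_of_checkExp' c.S c.alpha (DPoly c) ED (multD c) RD c.cD eD hD vD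
      hu hv ht hms)
    (fun u v t hu hv ht hms => le_of_checkExp' c.S c.betab (ObPoly c) EB (multB c) RB c.cB eB hBx vB
      hu hv ht hms)
    (fun u v t hu hv ht hms => le_of_checkExp' c.S c.betan (OnPoly c) EN (multN c) RN c.cN eN hNx vN
      hu hv ht hms)
    hX1 hcard hsep hB hdeg hnb p hp

/-- **`BondToCap` from a certificate at the level `cb = 1084151/2000000 = 1 − 0.957²/2`.** -/
theorem bondToCap_of_checkAll (c : CapCert) (hc : checkAll c = true) (hN : c.cbN = 1084151)
    (hD : c.cbD = 2000000) : BondToCap := by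
  intro X B hX1 hcard hsep hB _hBcard hdeg hnb p hp
  obtain ⟨x, hx, hlt⟩ := exists_inner_gt_of_checkAll c hc hX1 hcard hsep hB hdeg hnb p hp
  refine ⟨x, hx, ?_⟩
  rw [hN, hD] at hlt
  push_cast at hlt
  have hd : dist p x ^ 2 = 2 - 2 * ⟪p, x⟫ := by
    rw [dist_eq_norm, ← real_inner_self_eq_norm_sq, inner_sub_left, inner_sub_right,
      inner_sub_right, real_inner_self_eq_norm_sq, real_inner_self_eq_norm_sq, hp, hX1 x hx,
      real_inner_comm p x]
    ring
  have h2 : dist p x ^ 2 < (0.957 : ℝ) ^ 2 := by rw [hd]; norm_num at hlt ⊢; linarith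
  exact (pow_lt_pow_iff_left₀ dist_nonneg (by norm_num) two_ne_zero).1 h2

end Summit.AtomisticToContinuum.Crystallization.Theorems.Cap.Cert
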